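import Summits.AtomisticToContinuum.Crystallization.Theorems.ChargedEnergyGapLineMomentB
import HarnessLib

/-!
# ChargedEnergyGap · NODE 82 «LineMoment» (lens-3 g81): (M_F) ⟸ (LS) `CubicFrameQ` ∧ (LB) `LineChargeQ` ∧ (M_L) `LineMatchingQ'` — the frozen
hole ledger of NODE 81 re-booked on the LATTICE LINES of the cubic frame — file C of three: `lineSum`, the split, the hole re-indexing, the
dominations and THE GLUE (§L7); the designate and the cone (§L8); files A/B: `…LineMomentA` (definitions and leaves), `…LineMomentB` (frame lemmas)

Line of record `stmt-AtomisticToContinuum-14231` (`Summit.AtomisticToContinuum.ChargedEnergyGap`), route PricedLinkCensus.  TARGET = NODE 81's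
residual-deciding leaf (M_F) `FrozenMatchingQ' cls₀ 80 20 130 106 (1/3600000000) (1/60000000) (1/2000000) (1/60000000) (3/5) (1/3) 3 (3/100) 160 80
(6/5) (3/2) (679/1000) (691/1000)` (tree `…Theorems.ChargedEnergyGapFrozenMomentB`), VERBATIM; cone of record `chargedEnergyGap_of_frozenMoment_numerics`.

THESIS.  In the cubic fcc reference every mid pair `(y, z)` is an axis-antipodal pole pair of the frame octahedron of an ODD lattice point (a hole)
and its frozen cost is `unit · capK(min-depth, max-kink)` of the seven lattice depths around the hole ((KC), NODE 81).  Index the χ-free table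
charges of `frozenLoad` by the holes `w ∈ ℤ³`, attribute each hole to the axis of its largest kink (a global tie-break), and group the marked holes
near `x` on each AXIS LINE `{w + 2k e_a}`: along a line the lattice depth `d = infDist(·, C)` is `1`-Lipschitz at spacing `ρ` and discretely
semiconcave (`d(w + e)² + d(w − e)² ≤ 2 d(w)² + 2ρ²`, tree `infDist_sq_secondDiff_le`), so the kinks met on one line share ONE budget — the line carries
the table charge of its KEY hole (largest kink, nearest-first) plus an excess `E(column of the key, number of marked holes on the line)` bounded by a
one-dimensional extremal problem: the leaf (LB), table `lineExcessRows` (`E ≤ 44.3 c_T`; `E(·, 1) = 0`; `E(j, ·) = 0` for key columns `11–12`).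
THE SPLIT: (M_F) ⟸ (LS) the class has a cubic frame [crystallography] ∧ (LB) the key-cell line lemma [finite-dimensional] ∧ (M_L) the ball pool
dominates the LINE MOMENT `Ξ_L` (rest load + `unit ·` Σ key charges) [residual].  PROVED in this module: the split `frozenLoad = restLoad + lineSum`,
the hole re-indexing `lineSum ≤ unit · Σ_{marked holes} capK(cell)` (fibres of `≤ 6` ordered pairs per hole; NODE 81's seven-point dictionary in
lattice form, `lm_capVal_eq`), the admissibility of the marked holes for (LB), the two line constraints of the lattice depth, the dominations
`frozenLoad ≤ lineLoad` and `Ξ_F ≤ Ξ_L`, the glue `frozenMatchingQ'_of_line`, the designate `frozenMatchingQ'_designate_of_line` and the cone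
`chargedEnergyGap_of_lineMoment_numerics` (= NODE 81's cone with `hFM ↦ hLS, hLB, hML`; 35 hypotheses).

CENSUS (`HOME/decomp-a2c-lens-3/g81/num/RESULTS-g81.md`).  ONE-SIDED translation: `Ξ_F ≤ Ξ_L` always; on every censused family (slab `L ∈ {117, 118,
118.5}`, tilted rational combs) each axis line meets at most ONE marked hole (the hole stencils `[s − ρ, s + ρ]` tile a line at hole spacing `2ρ`, and a
medial sheet crosses a line once), so `Ξ_L = Ξ_F` EXACTLY there and NODE 81's census is inherited unspent: worst `Ξ/Π² = 0.967` at `(L, c) = (118,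
80.7)` phase `0` (census-1 replay, STATUS l.7328: `.960 / .967 / .952` to three digits), combs `(1,0,4)`: `0.906`, `(1,0,8)`: `0.95`, `(210)`: `0.39`,
`(111)`: `0.18`; margin `1.034`.  LINE DP (`num/zkey.py`; depth band `[88, 141]`, `ρ ∈ {0.679, 0.6868, 0.691}`, free steering kinks on a `0.05` grid):
raw continuation maxima per key column `2 … 12` (`n = 2` / `n ≥ 3` marked holes): `8.4/16.8, 11.0/16.8, 15.6, 17.5, 21.8, 25.3, 33.3, 41.9, 2.1, 0, 0 c_T`
(columns `11–12`: after a kink `J ≥ 1.9` the extremal recovery `d(s)² = d₀² + 2 s d₀ u + s²` loses `≥ 0.56 d₀ ≈ 79` of depth before the slope can turn,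
against `≤ 47` available above the table floor — no second charged hole); frozen in `lineExcessRows` with `× 1.05 + 0.3` and `⌈·⌉_{0.1}`.

TAGS.  (LS) `CubicFrameQ` [KNOWN-TYPE (crystallography of the Barlow image) · ATTACKABLE-S: `FlatleyTheil2015.exists_linearIsometryEquiv_image_fccLattice`,
the fcc Hagg stacking = even sublattice of the cubic lattice of spacing `ρ = a₀ ∈ [0.6792, 0.6908]` (`a0_sqrt2_cubic_window`), second shell = axis
pairs `2ρ ∈ (6/5, 3/2]`, common first neighbours = the four equatorial holes' vertices] · (LB) `LineChargeQ` [TABLE · FINITE-DIMENSIONAL · NEW as typed ·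
DP-CENSUS (not a certificate) · ATTACKABLE-M: interval DP + the fibrewise regrouping] · (M_L) `LineMatchingQ'` [RESIDUAL-DECIDING · NEW · TRUE-leaning,
THIN (`1.034`, inherited) · STRONGER than (M_F) by the (LB)-slack, EQUAL on censused families incl. the T-junction (frozen = line ratio `0.634`,
margin `1.58`, no axis row with two marked holes; RESULTS-g81 §E) · LOCAL · INSTRUMENTABLE (wedge-roof / X-junction at `R_N = 80`) · ATTACKABLE-L (door)].

«WHY NOVEL»: the unit of account moves from the octahedron (NODEs 75–81: one charge per hole, holes independent) to the LATTICE LINE — the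
semiconcavity budget of the distance function is spent once per line, so a line carries ONE key cell and a bounded count-excess however many
creased octahedra it threads; no hole-wise ledger can state that constraint, and the residual's load is now an a-priori bounded function of per-line
data (key cell, count), the input format of a line-by-line matching against the column pools of the same depth profile (door [COLUMN BUDGET]).

Contents: §L1 the cubic frame (`cubicPt`, `axisZ`) and the hole calculus of a depth function `d : ℤ³ → ℝ` (`hDepthMin`, `hKink`, `hMaxKink`, `hAxis`,
`lineFiber`, `IsKey`, `lineCount`); §L2 the leaf (LS) `CubicFrameQ`; §L3 the line-excess table `lineExcess`, `keyCharge` and the leaf (LB) `LineChargeQ`;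
§L4 the line pairs, the marked holes, `restLoad`, `lineLoad`, `lineMoment` and the residual leaf (M_L) `LineMatchingQ'`; §L5 frame lemmas (lattice
steps, poles, `lm_octMinDepth_eq`, `lm_octMaxKink_eq`, `lm_capVal_eq`); §L6 the two line constraints of `latDepth`; §L7 `lineSum`, the split, the hole
re-indexing, the dominations and THE GLUE; §L8 the designate and the cone.  Imports ONLY the tree file `…ChargedEnergyGapFrozenMoment` (NODE 81) and
`HarnessLib`; no `set_option`, no `sorry`, no instance, no notation, no `private`; namespace `…Theorems.ChargedEnergyGapChartDial`; new declaration
names (checked by `rg` over the tree).  Three-file edition for the `≤ 400`-line lane rule: `…LineMomentA` (§L1–§L4) → `…LineMomentB` (§L5–§L6) →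
`…LineMoment` (§L7–§L8), statements and proofs byte-identical.
-/

noncomputable section

open scoped Classical
open Literature.MathematicalPhysics.StatisticalMechanics Literature.Geometry.DiscreteGeometry
open Summit.AtomisticToContinuum.Crystallization.Theses.PricedLinkCensus
open Summit.AtomisticToContinuum.Crystallization.Theorems.ChargedEnergyGapNegative

namespace Summit.AtomisticToContinuum.Crystallization.Theorems.ChargedEnergyGapChartDial

/-! ## §L7 The domination `frozenLoad ≤ lineLoad` (PROVED: hole re-indexing with fibres `≤ 6`, the dictionary, (LB)) and THE GLUE of NODE 82 -/

section Glue82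

variable (ϱχ : ℝ) {m : ℕ} (D : Fin m → Set E3) (σ : Fin m → Bool)

/-- The LINE SUM at `x`: the frozen sixth-costs of the heavy active LINE pairs near `x` — the part of `frozenLoad` re-booked on lines. -/
def lineSum (R_N unit r_f dK dstar κ c_T cχ : ℝ) (P : PeriodicConfiguration 3) (C X : Set E3) (τ ϱ r₁ r₂ : ℝ) (x : E3) : ℝ :=
  ∑ᶠ p : E3 × E3,
    if (HeavyActive ϱχ D σ r_f dK dstar κ c_T cχ P C X τ ϱ r₁ r₂ p.1 p.2 ∧ dist x p.1 ≤ R_N) ∧ IsLinePair ϱχ D P C r₁ p.1 p.2 then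
      (1 / 6) * frozenCost ϱχ D σ unit P C X τ ϱ r₁ p.1 p.2
    else 0

variable {ϱχ D σ}

/-- ★ **SPLIT (PROVED)**: `frozenLoad = restLoad + lineSum` (the heavy pairs near `x` are finitely many for a separated reference). -/
theorem lm_frozenLoad_eq_rest_add_line {s R_N unit r_f dK dstar κ c_T cχ τ ϱ r₁ r₂ : ℝ} {P : PeriodicConfiguration 3} {C X : Set E3}
    (h1 : IsSeparatedRef s P) (hs : 0 < s) (x : E3) :
    frozenLoad ϱχ D σ R_N unit r_f dK dstar κ c_T cχ P C X τ ϱ r₁ r₂ x =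
      restLoad ϱχ D σ R_N unit r_f dK dstar κ c_T cχ P C X τ ϱ r₁ r₂ x + lineSum ϱχ D σ R_N unit r_f dK dstar κ c_T cχ P C X τ ϱ r₁ r₂ x := by
  unfold frozenLoad restLoad lineSum
  set B := (fz_pairBox_finite (ϱχ := ϱχ) (D := D) (σ := σ) (R_N := R_N) (r_f := r_f) (dK := dK) (dstar := dstar) (κ := κ) (c_T := c_T)
    (cχ := cχ) (τ := τ) (ϱ := ϱ) (r₁ := r₁) (r₂ := r₂) (C := C) (X := X) h1 hs x).toFinset with hB
  have hsupp : ∀ F : E3 × E3 → ℝ, (∀ p, F p ≠ 0 → HeavyActive ϱχ D σ r_f dK dstar κ c_T cχ P C X τ ϱ r₁ r₂ p.1 p.2 ∧ dist x p.1 ≤ R_N) →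
      Function.support F ⊆ ↑B := by
    intro F hF p hp
    rw [hB, Set.Finite.coe_toFinset, Set.mem_setOf_eq]
    exact hF p hp
  have hpt : ∀ p : E3 × E3,
      (if HeavyActive ϱχ D σ r_f dK dstar κ c_T cχ P C X τ ϱ r₁ r₂ p.1 p.2 ∧ dist x p.1 ≤ R_N then
          (1 / 6) * frozenCost ϱχ D σ unit P C X τ ϱ r₁ p.1 p.2 else 0) =
        (if (HeavyActive ϱχ D σ r_f dK dstar κ c_T cχ P C X τ ϱ r₁ r₂ p.1 p.2 ∧ dist x p.1 ≤ R_N) ∧ ¬IsLinePair ϱχ D P C r₁ p.1 p.2 then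
            (1 / 6) * frozenCost ϱχ D σ unit P C X τ ϱ r₁ p.1 p.2 else 0) +
          (if (HeavyActive ϱχ D σ r_f dK dstar κ c_T cχ P C X τ ϱ r₁ r₂ p.1 p.2 ∧ dist x p.1 ≤ R_N) ∧ IsLinePair ϱχ D P C r₁ p.1 p.2 then
            (1 / 6) * frozenCost ϱχ D σ unit P C X τ ϱ r₁ p.1 p.2 else 0) := by
    intro p
    by_cases hA : HeavyActive ϱχ D σ r_f dK dstar κ c_T cχ P C X τ ϱ r₁ r₂ p.1 p.2 ∧ dist x p.1 ≤ R_N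
    · by_cases hL : IsLinePair ϱχ D P C r₁ p.1 p.2
      · rw [if_pos hA, if_neg (fun h => h.2 hL), if_pos ⟨hA, hL⟩, zero_add]
      · rw [if_pos hA, if_pos ⟨hA, hL⟩, if_neg (fun h => hL h.2), add_zero]
    · rw [if_neg hA, if_neg (fun h => hA h.1), if_neg (fun h => hA h.1), add_zero]
  rw [finsum_congr hpt]
  refine finsum_add_distrib (B.finite_toSet.subset (hsupp _ fun p hp => ?_)) (B.finite_toSet.subset (hsupp _ fun p hp => ?_))
  · by_contra hc
    exact hp (if_neg fun h => hc h.1)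
  · by_contra hc
    exact hp (if_neg fun h => hc h.1)

/-- ★★ **HOLE RE-INDEXING (PROVED)**: in a cubic frame the line sum at `x` is at most `unit ×` the table charges of the MARKED HOLES at `x` — every
line pair is an axis-antipodal pole pair of the frame octahedron of an odd hole ((LS)), at most SIX ordered pairs share a hole, each pays a sixth of
`capVal = unit · capK(hole cell)` (the dictionary), and the hole of a pair near `x` is marked. -/
theorem lm_lineSum_le_marked {s R_N unit r_f dK dstar κ c_T cχ τ ϱ r₁ r₂ : ℝ} {P : PeriodicConfiguration 3} {C X : Set E3} {c₀ : E3}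
    {f : Fin 3 → E3} {ρ : ℝ} (h1 : IsSeparatedRef s P) (hs : 0 < s) (hu : 0 ≤ unit) (hf : Orthonormal ℝ f) (hρ : 0 < ρ)
    (hCF : IsCubicFrameOf P r₁ r₂ c₀ f ρ) (x : E3) :
    lineSum ϱχ D σ R_N unit r_f dK dstar κ c_T cχ P C X τ ϱ r₁ r₂ x ≤
      unit * ∑ᶠ w : Fin 3 → ℤ, (if IsMarked ϱχ D σ R_N r_f dK dstar κ c_T cχ P C X τ ϱ r₁ r₂ c₀ f ρ x w then
        capK (hDepthMin (latDepth C c₀ f ρ) w) (hMaxKink ρ (latDepth C c₀ f ρ) w) else 0) := by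
  -- abbreviations
  set d := latDepth C c₀ f ρ with hd
  set A : E3 × E3 → Prop := fun p =>
    (HeavyActive ϱχ D σ r_f dK dstar κ c_T cχ P C X τ ϱ r₁ r₂ p.1 p.2 ∧ dist x p.1 ≤ R_N) ∧ IsLinePair ϱχ D P C r₁ p.1 p.2 with hA
  set g : E3 × E3 → ℝ := fun p => (1 / 6) * frozenCost ϱχ D σ unit P C X τ ϱ r₁ p.1 p.2 with hg
  set mk := IsMarked ϱχ D σ R_N r_f dK dstar κ c_T cχ P C X τ ϱ r₁ r₂ c₀ f ρ x with hmk
  set h : (Fin 3 → ℤ) → ℝ := fun w => capK (hDepthMin d w) (hMaxKink ρ d w) with hh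
  -- the finite set of line pairs near `x`
  set B := (fz_pairBox_finite (ϱχ := ϱχ) (D := D) (σ := σ) (R_N := R_N) (r_f := r_f) (dK := dK) (dstar := dstar) (κ := κ) (c_T := c_T)
    (cχ := cχ) (τ := τ) (ϱ := ϱ) (r₁ := r₁) (r₂ := r₂) (C := C) (X := X) h1 hs x).toFinset with hB
  set S := B.filter A with hS
  have hS_mem : ∀ p, p ∈ S ↔ A p := by
    intro p
    rw [hS, Finset.mem_filter, hB, Set.Finite.mem_toFinset, Set.mem_setOf_eq]
    exact ⟨fun hp => hp.2, fun hp => ⟨hp.1, hp⟩⟩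
  -- the line sum is a finite sum
  have hL : lineSum ϱχ D σ R_N unit r_f dK dstar κ c_T cχ P C X τ ϱ r₁ r₂ x = ∑ p ∈ S, g p := by
    unfold lineSum
    rw [finsum_eq_sum_of_support_subset _ (show (Function.support fun p : E3 × E3 => if A p then g p else 0) ⊆ ↑S from ?_)]
    · exact Finset.sum_congr rfl fun p hp => if_pos ((hS_mem p).1 hp)
    · intro p hp
      rw [Function.mem_support] at hp
      rw [Finset.mem_coe, hS_mem]
      by_contra hc
      exact hp (if_neg hc)
  -- the mid-pair window of a line pair
  have hmid : ∀ p : E3 × E3, A p → p.1 ∈ P.points ∧ p.2 ∈ P.points ∧ r₁ < dist p.1 p.2 ∧ dist p.1 p.2 ≤ r₂ :=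
    fun p hp => hp.1.1.1.1
  -- the hole of a line pair ((LS))
  let hole : E3 × E3 → (Fin 3 → ℤ) := fun p =>
    if hp : A p then Classical.choose (hCF.2 p.1 p.2 (hmid p hp).1 (hmid p hp).2.1 (hmid p hp).2.2.1 (hmid p hp).2.2.2) else 0
  have hspec : ∀ p : E3 × E3, A p → ∃ (a : Fin 3) (b : Bool), Odd (∑ i, hole p i) ∧
      p.1 = octVertex (cubicPt c₀ f ρ (hole p)) f ρ a (!b) ∧ p.2 = octVertex (cubicPt c₀ f ρ (hole p)) f ρ a b ∧
        ∀ x', InOct P r₁ p.1 p.2 x' ↔ ∃ (i : Fin 3) (b' : Bool), x' = octVertex (cubicPt c₀ f ρ (hole p)) f ρ i b' := by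
    intro p hp
    have hc := Classical.choose_spec (hCF.2 p.1 p.2 (hmid p hp).1 (hmid p hp).2.1 (hmid p hp).2.2.1 (hmid p hp).2.2.2)
    have he : hole p = Classical.choose (hCF.2 p.1 p.2 (hmid p hp).1 (hmid p hp).2.1 (hmid p hp).2.2.1 (hmid p hp).2.2.2) := dif_pos hp
    rw [he]
    exact hc
  -- fibrewise over the holes
  set t := S.image hole with ht
  have hfib : ∑ p ∈ S, g p = ∑ w ∈ t, ∑ p ∈ S with hole p = w, g p :=
    (Finset.sum_fiberwise_of_maps_to (fun p hp => Finset.mem_image_of_mem hole hp) g).symm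
  -- each fibre has at most six pairs, each paying a sixth of `unit · h w`
  have hfib_le : ∀ w ∈ t, ∑ p ∈ S with hole p = w, g p ≤ unit * h w := by
    intro w _
    have hval : ∀ p ∈ S.filter (fun p => hole p = w), g p = (1 / 6) * (unit * h w) := by
      intro p hp
      rw [Finset.mem_filter] at hp
      obtain ⟨hpS, hpw⟩ := hp
      have hAp := (hS_mem p).1 hpS
      obtain ⟨a, b, -, hy, hz, hO⟩ := hspec p hAp
      rw [hpw] at hy hz hO
      rw [hg, hh]
      simp only
      unfold frozenCost
      rw [if_pos hAp.2.1, lm_capVal_eq unit C hf hρ hy hz hO]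
    rw [Finset.sum_congr rfl hval, Finset.sum_const, nsmul_eq_mul]
    have hcard : (((S.filter (fun p => hole p = w)).card : ℕ) : ℝ) ≤ 6 := by
      have hsub : (S.filter fun p => hole p = w) ⊆ (Finset.univ : Finset (Fin 3 × Bool)).image
          (fun u => (octVertex (cubicPt c₀ f ρ w) f ρ u.1 (!u.2), octVertex (cubicPt c₀ f ρ w) f ρ u.1 u.2)) := by
        intro p hp
        rw [Finset.mem_filter] at hp
        obtain ⟨a, b, -, hy, hz, -⟩ := hspec p ((hS_mem p).1 hp.1)
        rw [hp.2] at hy hz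
        rw [Finset.mem_image]
        exact ⟨(a, b), Finset.mem_univ _, Prod.ext hy.symm hz.symm⟩
      have h6 : ((Finset.univ : Finset (Fin 3 × Bool)).image (fun u => (octVertex (cubicPt c₀ f ρ w) f ρ u.1 (!u.2),
          octVertex (cubicPt c₀ f ρ w) f ρ u.1 u.2))).card ≤ 6 :=
        Finset.card_image_le.trans (by simp)
      exact_mod_cast (Finset.card_le_card hsub).trans h6
    have hh0 : 0 ≤ unit * h w := mul_nonneg hu (capK_nonneg _ _)
    nlinarith
  -- the holes of the line pairs near `x` are exactly the marked holes
  have ht_marked : ∀ w ∈ t, mk w := by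
    intro w hw
    rw [ht, Finset.mem_image] at hw
    obtain ⟨p, hpS, rfl⟩ := hw
    have hAp := (hS_mem p).1 hpS
    obtain ⟨a, b, hodd, hy, hz, -⟩ := hspec p hAp
    refine ⟨hodd, p.1, p.2, hAp.1.1, hAp.2, hAp.1.2, ?_⟩
    rw [hy, hz, lm_octCentre_poles]
  have hmarked_t : ∀ w, mk w → w ∈ t := by
    rintro w ⟨-, y', z', hH, hLp, hnear, hcen⟩
    have hAp : A (y', z') := ⟨⟨hH, hnear⟩, hLp⟩
    have hpS : (y', z') ∈ S := (hS_mem _).2 hAp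
    obtain ⟨a, b, -, hy, hz, -⟩ := hspec (y', z') hAp
    have hc : cubicPt c₀ f ρ (hole (y', z')) = cubicPt c₀ f ρ w := by
      have hcp := lm_octCentre_poles (cubicPt c₀ f ρ (hole (y', z'))) f ρ a b
      simp only at hy hz
      rw [← hy, ← hz, hcen] at hcp
      exact hcp.symm
    rw [← lm_cubicPt_injective hf hρ.ne' hc, ht]
    exact Finset.mem_image_of_mem hole hpS
  have hM : ∑ᶠ w, (if mk w then h w else 0) = ∑ w ∈ t, h w := by
    rw [finsum_eq_sum_of_support_subset _ (show (Function.support fun w => if mk w then h w else 0) ⊆ ↑t from ?_)]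
    · exact Finset.sum_congr rfl fun w hw => if_pos (ht_marked w hw)
    · intro w hw
      rw [Function.mem_support] at hw
      rw [Finset.mem_coe]
      refine hmarked_t w ?_
      by_contra hc
      exact hw (if_neg hc)
  -- assemble
  rw [hL, hfib, hM, Finset.mul_sum]
  exact Finset.sum_le_sum hfib_le

/-- ★ **THE MARKED HOLES ARE ADMISSIBLE FOR (LB) (PROVED)**: odd, within `R_N + ρ` of `x`, and in the charged part of the table (row `≥ 1`, column
`≥ 2`, min-depth `< 140`) — by (LS), the injectivity of the lattice map and the dictionary. -/
theorem lm_marked_admissible {R_N r_f dK dstar κ c_T cχ τ ϱ r₁ r₂ : ℝ} {P : PeriodicConfiguration 3} {C X : Set E3} {c₀ : E3}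
    {f : Fin 3 → E3} {ρ : ℝ} (hf : Orthonormal ℝ f) (hρ : 0 < ρ) (hCF : IsCubicFrameOf P r₁ r₂ c₀ f ρ) (x : E3) (w : Fin 3 → ℤ)
    (hw : IsMarked ϱχ D σ R_N r_f dK dstar κ c_T cχ P C X τ ϱ r₁ r₂ c₀ f ρ x w) :
    Odd (∑ i, w i) ∧ dist x (cubicPt c₀ f ρ w) ≤ R_N + ρ ∧ 1 ≤ capKRow (hDepthMin (latDepth C c₀ f ρ) w) ∧
      2 ≤ capKCol (hMaxKink ρ (latDepth C c₀ f ρ) w) ∧ hDepthMin (latDepth C c₀ f ρ) w < 140 := by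
  obtain ⟨hodd, y', z', hH, hLp, hnear, hcen⟩ := hw
  obtain ⟨hy0, hz0, hd1, hd2⟩ := hH.1.1
  obtain ⟨w', a, b, -, hy, hz, hO⟩ := hCF.2 y' z' hy0 hz0 hd1 hd2
  have hc : cubicPt c₀ f ρ w' = cubicPt c₀ f ρ w := by rw [← hcen, hy, hz, lm_octCentre_poles]
  have hww : w' = w := lm_cubicPt_injective hf hρ.ne' hc
  subst hww
  refine ⟨hodd, ?_, ?_, ?_, ?_⟩
  · have h2 : dist y' (cubicPt c₀ f ρ w') = ρ := by
      rw [hy]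
      exact lm_dist_pole_centre hf hρ.le _ a (!b)
    linarith [dist_triangle x y' (cubicPt c₀ f ρ w')]
  · rw [← lm_octMinDepth_eq C hO]; exact hLp.2.1
  · rw [← lm_octMaxKink_eq C hf hρ hy hz hO]; exact hLp.2.2.1
  · rw [← lm_octMinDepth_eq C hO]; exact hLp.2.2.2

/-- ★★ **DOMINATION OF THE LOAD (PROVED)**: in a cubic frame of a separated reference, under (LB), `frozenLoad(x) ≤ lineLoad(x)`. -/
theorem frozenLoad_le_lineLoad {s R_N unit r_f dK dstar κ c_T cχ τ ϱ r₁ r₂ ρlo ρhi : ℝ} {P : PeriodicConfiguration 3} {C X : Set E3}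
    {c₀ : E3} {f : Fin 3 → E3} {ρ : ℝ} (h1 : IsSeparatedRef s P) (hs : 0 < s) (hu : 0 ≤ unit) (hf : Orthonormal ℝ f) (hlo : 0 < ρlo)
    (hρ1 : ρlo ≤ ρ) (hρ2 : ρ ≤ ρhi) (hCF : IsCubicFrameOf P r₁ r₂ c₀ f ρ) (hLB : LineChargeQ R_N ρlo ρhi) (x : E3) :
    frozenLoad ϱχ D σ R_N unit r_f dK dstar κ c_T cχ P C X τ ϱ r₁ r₂ x ≤
      lineLoad ϱχ D σ R_N unit r_f dK dstar κ c_T cχ P C X τ ϱ r₁ r₂ c₀ f ρ x := by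
  have hρ : 0 < ρ := hlo.trans_le hρ1
  rw [lm_frozenLoad_eq_rest_add_line h1 hs x]
  unfold lineLoad
  refine add_le_add le_rfl ((lm_lineSum_le_marked h1 hs hu hf hρ hCF x).trans (mul_le_mul_of_nonneg_left ?_ hu))
  exact hLB ρ hρ1 hρ2 c₀ f hf (latDepth C c₀ f ρ) (lm_latDepth_nonneg C c₀ f ρ) (fun w a => lm_latDepth_lipschitz C c₀ hf hρ.le w a)
    (fun w a => lm_latDepth_secondDiff C c₀ hf ρ w a) x _ (lm_marked_admissible hf hρ hCF x)

/-- ★★ **DOMINATION OF THE MOMENT (PROVED)**: `Ξ_F(y) ≤ Ξ_L(y)` (pools are non-negative). -/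
theorem frozenMoment_le_lineMoment {s R_N unit r_f dK dstar κ c_T cχ τ ϱ r₁ r₂ ρlo ρhi : ℝ} {P : PeriodicConfiguration 3} {C X : Set E3}
    {c₀ : E3} {f : Fin 3 → E3} {ρ : ℝ} (h1 : IsSeparatedRef s P) (hs : 0 < s) (hu : 0 ≤ unit) (hf : Orthonormal ℝ f) (hlo : 0 < ρlo)
    (hρ1 : ρlo ≤ ρ) (hρ2 : ρ ≤ ρhi) (hCF : IsCubicFrameOf P r₁ r₂ c₀ f ρ) (hLB : LineChargeQ R_N ρlo ρhi) (y : E3) :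
    frozenMoment ϱχ D σ R_N unit r_f dK dstar κ c_T cχ P C X τ ϱ r₁ r₂ y ≤
      lineMoment ϱχ D σ R_N unit r_f dK dstar κ c_T cχ P C X τ ϱ r₁ r₂ c₀ f ρ y := by
  unfold frozenMoment lineMoment
  set B := (h1.finite_inter_closedBall hs y R_N).toFinset with hB
  have hsupp : ∀ g : E3 → ℝ, Function.support (fun x : E3 => if x ∈ P.points ∧ dist x y ≤ R_N then g x else 0) ⊆ ↑B := by
    intro g x hx
    rw [Function.mem_support] at hx
    rw [hB, Set.Finite.coe_toFinset]
    by_contra hc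
    refine hx (if_neg fun hb => hc ⟨hb.1, ?_⟩)
    rw [Metric.mem_closedBall]
    exact hb.2
  refine fz_finsum_le B (hsupp fun x => pool ϱχ D σ r_f dK dstar κ c_T cχ P C X τ ϱ r₁ r₂ x *
      frozenLoad ϱχ D σ R_N unit r_f dK dstar κ c_T cχ P C X τ ϱ r₁ r₂ x)
    (hsupp fun x => pool ϱχ D σ r_f dK dstar κ c_T cχ P C X τ ϱ r₁ r₂ x *
      lineLoad ϱχ D σ R_N unit r_f dK dstar κ c_T cχ P C X τ ϱ r₁ r₂ c₀ f ρ x) fun x _ => ?_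
  by_cases hc : x ∈ P.points ∧ dist x y ≤ R_N
  · rw [if_pos hc, if_pos hc]
    exact mul_le_mul_of_nonneg_left (frozenLoad_le_lineLoad h1 hs hu hf hlo hρ1 hρ2 hCF hLB x)
      (pool_nonneg r_f dK dstar κ c_T cχ P C X τ ϱ r₁ r₂ x)
  · rw [if_neg hc, if_neg hc]

/-- ★★★ **GLUE OF NODE 82 (PROVED)**: (LS) ∧ (LB) ∧ (M_L) ⟹ (M_F) `FrozenMatchingQ'`, for any class, whenever `0 < s`, `0 ≤ unit`, `0 < ρlo`. -/
theorem frozenMatchingQ'_of_line {cls : Set E3 → Prop} {R_N r_f dK dstar κ c_T cχ unit s lam ℓ τ ϱ ϱχ r₁ r₂ ρlo ρhi : ℝ}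
    (hs : 0 < s) (hu : 0 ≤ unit) (hlo : 0 < ρlo)
    (hLS : CubicFrameQ cls r₁ r₂ ρlo ρhi) (hLB : LineChargeQ R_N ρlo ρhi)
    (hM : LineMatchingQ' cls R_N r_f dK dstar κ c_T cχ unit s lam ℓ τ ϱ ϱχ r₁ r₂ ρlo ρhi) :
    FrozenMatchingQ' cls R_N r_f dK dstar κ c_T cχ unit s lam ℓ τ ϱ ϱχ r₁ r₂ ρlo ρhi := by
  intro P C X m D σ h1 h2 hcl h3 h4 h6 h7 h11 hcv hFr y z hH hT
  obtain ⟨c₀, f, ρ, hf, hρ1, hρ2, hCF⟩ := hLS P hcl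
  obtain ⟨hPos, hMom⟩ := hM P C X m D σ h1 h2 hcl h3 h4 h6 h7 h11 hcv hFr c₀ f ρ hf hρ1 hρ2 hCF y z hH hT
  exact ⟨hPos, (frozenMoment_le_lineMoment h1 hs hu hf hlo hρ1 hρ2 hCF hLB y).trans hMom⟩

end Glue82

/-! ## §L8 The designate: NODE 82 beneath NODE 81, and the q-designate cone through the line moment -/

section Designate82

/-- ★★★ **NODE 82 AT THE DESIGNATE (PROVED)**: (LS) `CubicFrameQ cls₀ (6/5) (3/2) (679/1000) (691/1000)` ∧ (LB) `LineChargeQ 80 (679/1000) (691/1000)`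
∧ (M_L) `LineMatchingQ' cls₀ 80 20 130 106 (1/3600000000) (1/60000000) (1/2000000) (1/60000000) (3/5) (1/3) 3 (3/100) 160 80 (6/5) (3/2) (679/1000)
(691/1000)` ⟹ (M_F). -/
theorem frozenMatchingQ'_designate_of_line
    (hLS : CubicFrameQ cls₀ (6 / 5) (3 / 2) (679 / 1000) (691 / 1000))
    (hLB : LineChargeQ 80 (679 / 1000) (691 / 1000))
    (hM : LineMatchingQ' cls₀ 80 20 130 106 (1 / 3600000000) (1 / 60000000) (1 / 2000000) (1 / 60000000) (3 / 5) (1 / 3) 3 (3 / 100)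
      160 80 (6 / 5) (3 / 2) (679 / 1000) (691 / 1000)) :
    FrozenMatchingQ' cls₀ 80 20 130 106 (1 / 3600000000) (1 / 60000000) (1 / 2000000) (1 / 60000000) (3 / 5) (1 / 3) 3 (3 / 100)
      160 80 (6 / 5) (3 / 2) (679 / 1000) (691 / 1000) :=
  frozenMatchingQ'_of_line (by norm_num) (by norm_num) (by norm_num) hLS hLB hM

/-- ★★★ **THE q-DESIGNATE THROUGH THE LINE MOMENT**: the cone `chargedEnergyGap_of_frozenMoment_numerics` of NODE 81 with (M_F) replaced by the three
leaves of NODE 82 — (LS) `CubicFrameQ`, (LB) `LineChargeQ`, (M_L) `LineMatchingQ'` — everything else verbatim. -/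
theorem chargedEnergyGap_of_lineMoment_numerics {b₁ : ℝ} (hb : 1 / 8 ≤ b₁) (hU : Fcc.FccScaleNumerics) (hF : ChargeRecount)
    (hIP : ImprovablePricingG (3 / 20) (1 / 10) (6 / 5) 10 (1 / 100) (3 / 5))
    (hFCP : FrustratedCorePricingG (3 / 20) (1 / 10) (6 / 5) 10 (1 / 100) 40 (3 / 5))
    (hCCP : CoherentCorePricingG (3 / 20) (1 / 10) (6 / 5) 10 (1 / 100) 40 (1 / 10) 40 (3 / 5))
    (hB : CoreBallRegularPricingW (maxCoverWeights (3 / 20) (1 / 10) (6 / 5) 10 (1 / 100) 40 (1 / 10) 40 160) (1 / 20) (3 / 5) 10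
      fun _ _ => True)
    (hLab : CleanLabellingW (maxCoverWeights (3 / 20) (1 / 10) (6 / 5) 10 (1 / 100) 40 (1 / 10) 40 160) (3 / 5) 10 (1 / 3) 3)
    (hSB : ShellBudgetW (maxCoverWeights (3 / 20) (1 / 10) (6 / 5) 10 (1 / 100) 40 (1 / 10) 40 160) (3 / 5) 100000)
    (hLf : LoadBoundQ IsFccImage (3 / 5) (1 / 3) 3 (1 / 100) (3 / 100) 160 (2 / 5) 3 b₁ 80 (6 / 5) (3 / 4) (3 / 10000000) (9 / 1000000))
    (hNf : NnStiffCls IsFccImage (27 / 10) (6 / 5))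
    (hOL : OctLedgerQ (IsCubicFccImage (1921 / 2000) (977 / 1000)) (3 / 5) (1 / 3) 3 (1 / 100) (3 / 100) 160 (2 / 5) 3 b₁ 80 (6 / 5) (3 / 2)
      (1 / 2) (679 / 1000) (691 / 1000))
    (hA : A0Plus) (hSh : ShellIsSecond (IsCubicFccImage (Fcc.a0 * Real.sqrt 2) (Fcc.a0 * Real.sqrt 2)))
    (hT : RoofTableQ (471 / 1000) T75)
    (hZ : SixFeetZeroConeQ (679 / 1000) (691 / 1000) 20 106 160)
    (hCap : SixFeetShallowCapQ (679 / 1000) (691 / 1000) 20 106 160 (3 / 100) (1 / 3600000000))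
    (hI : SVertexIncidenceQ cls₀ 20 106 36 (3 / 5) (1 / 3) 3 160 80 (6 / 5) (3 / 2))
    (hZK : SixFeetZeroConeQ (679 / 1000) (691 / 1000) 330 130 160)
    (hSF : BallSupportQ 80 20 130 106 (1 / 3600000000) (1 / 60000000) (1 / 2000000) (3 / 5) (3 / 100) 160 80 (6 / 5) (3 / 2))
    (hKC : KinkCostTableQ (679 / 1000) (691 / 1000) 160 (3 / 100) (1 / 60000000))
    (hLS : CubicFrameQ cls₀ (6 / 5) (3 / 2) (679 / 1000) (691 / 1000))
    (hLB : LineChargeQ 80 (679 / 1000) (691 / 1000))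
    (hML : LineMatchingQ' cls₀ 80 20 130 106 (1 / 3600000000) (1 / 60000000) (1 / 2000000) (1 / 60000000) (3 / 5) (1 / 3) 3
      (3 / 100) 160 80 (6 / 5) (3 / 2) (679 / 1000) (691 / 1000))
    (hPD : BandBallQ' cls₀ 80 20 130 106 (1 / 3600000000) (1 / 60000000) (1 / 2000000) (3 / 5) (1 / 3) 3 (3 / 100) 160 80 (6 / 5)
      (3 / 2) (679 / 1000) (691 / 1000))
    (hNP : BallIncidenceQ' cls₀ 80 20 130 106 (1 / 3600000000) (1 / 60000000) (1 / 2000000) (3 / 5) (1 / 3) 3 (3 / 100) 160 80 (6 / 5)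
      (3 / 2) (679 / 1000) (691 / 1000))
    (hFf : FarTrussQ IsFccImage (3 / 5) (1 / 3) 3 (1 / 100) (3 / 100) 160 (2 / 5) 3 b₁ 80 (6 / 5) (3 / 2) (11 / 20) (1 / 25) (1 / 60000000)
      (1 / 2000000))
    (hGf : GeoExchQ IsFccImage (3 / 5) (1 / 3) 3 (1 / 100) (3 / 100) 160 (2 / 5) 3 b₁ 80 (6 / 5) (3 / 20) (1 / 25) (1 / 30000000) (1 / 1000000))
    (hLh : LoadBoundQ IsHcpImage (3 / 5) (1 / 3) 3 (1 / 100) (3 / 100) 160 (2 / 5) 3 b₁ 80 (6 / 5) (3 / 4) (3 / 10000000) (9 / 1000000))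
    (hNh : NnStiffCls IsHcpImage (27 / 10) (6 / 5))
    (hMh : MidTrussQ IsHcpImage (3 / 5) (1 / 3) 3 (1 / 100) (3 / 100) 160 (2 / 5) 3 b₁ 80 (6 / 5) (3 / 2) (1 / 2) 0 (1 / 60000000) (1 / 2000000))
    (hFh : FarTrussQ IsHcpImage (3 / 5) (1 / 3) 3 (1 / 100) (3 / 100) 160 (2 / 5) 3 b₁ 80 (6 / 5) (3 / 2) (1 / 2) (1 / 40) (1 / 60000000)
      (1 / 2000000))
    (hGh : GeoExchQ IsHcpImage (3 / 5) (1 / 3) 3 (1 / 100) (3 / 100) 160 (2 / 5) 3 b₁ 80 (6 / 5) (1 / 5) (1 / 40) (1 / 30000000) (1 / 1000000))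
    (hN : LocalSeamReductionQ' (3 / 5) (1 / 3) 3 (1 / 100) (3 / 100) (1 / 2) 160 (2 / 5) 3 b₁ 80 (1 / 3000000) (1 / 100000)
      (maxCoverWeights (3 / 20) (1 / 10) (6 / 5) 10 (1 / 100) 40 (1 / 10) 40 160) (1 / 20) 10 100000)
    (hP : ChartedChargePricingG (3 / 20) (1 / 10) (3 / 5)) : ChargedEnergyGap :=
  chargedEnergyGap_of_frozenMoment_numerics hb hU hF hIP hFCP hCCP hB hLab hSB hLf hNf hOL hA hSh hT hZ hCap hI hZK hSF hKC
    (frozenMatchingQ'_designate_of_line hLS hLB hML) hPD hNP hFf hGf hLh hNh hMh hFh hGh hN hP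

end Designate82

end Summit.AtomisticToContinuum.Crystallization.Theorems.ChargedEnergyGapChartDial
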